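/-
Copyright (c) 2026 the pub-hodgecm-mathlib formalisation cell (harness21).  Prover seat hodgecm-mathlib-LH7-p06 (g2), Track A «FOUR-FRAME» fan seat on VALVE DEAL of
L1 LEAD F0P6-plan (g14) BATCH #116 (2) 2026-09-04T23:02:54Z «U1 STAGE-3 B2b SECOND HAND — the LOCAL half» under K2E3-p28 (g3) (CUT 23:04:55Z (L1)–(L3));
desk K2E3-p14 (g9) «=» 23:12:19Z on the seam (i)–(v); B2a K2E3-p06 (g6); template ★ (K1a-3) `K2LiuRankOneSingularLocalRegularity` (K2E3-p29 (g2)).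
-/
import Summits.HodgeConjecture.HodgeConjecture.Theorems.K2LiuRankOneSingularLocalRegularity    -- ★ (K1a-3) p862716 (K2E3-p29): the chain (brings ★ (K1a-3)-S, ★ A7-AllS0, ★ B7-M2, ★ B4d-3, ★ B2)
import Summits.HodgeConjecture.HodgeConjecture.Theorems.K2LiuBigCellContinuationPointLetters   -- ★ (K2Liu-p13): `differentiableOn_re_pos_of_forall_isQRationalRegularAt`
import HarnessLib

/-!
# Crux `HLiu418`, organ U1-CT-ind STAGE 3 («U1-glob»), brick B2b — THE LOCAL HALF: THE STRUCTURED READING OF THE SINGULAR (RANK-ONE, CORNER-TWISTED) WHITTAKER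
# FUNCTIONAL AT A NON-SPLIT PLACE — `W_{σ,v}(f_s)(h) = κ(s) · N₃(s)(h)`, `N₃ = W^{st}_σ(N₂(s))` a finite linear form in the TWO-STEP family `N₂`

Cell `hodgecm-mathlib`, crux item hLiu418 = `stmt-HodgeConjecture-24832` (helper lane `--supports … --as helper`, count-neutral).  THEOREMS ONLY (no `def`,
no `instance`, no `notation`, no named-fact hypothesis, no `sorry`).  ONE FRAME (RULING M-156o (c)); binders = ★ (K1a-3)'s verbatim (+ the two Haar measures as inputs).

THE POINT.  U1-glob's brick B2b (K2E3-p28 (g3) `K2LiuSingularWhittakerPlaceFactor`: isolation (I) + transport (T), ★∕📤 p862928) consumes at the distinguished finite place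
`v₀` (non-split) three LOCAL letters: (L1) the reading `∫ conj ψ_S · b_s(w_Δ · hv) = Fn s hv` on `1 < re s`, (L2) `Fn(·, hv)` holomorphic on `{0 < re}`, (L3) `Fn(½) hv = 0` from
the tower step.  (L1)+(L2) are ★ (K1a-3) `K2LiuRankOneSingularLocalRegularity.twistedRankOneRegularity_of_forall_eq` (K2E3-p29) — but its `Gn` is EXISTENTIAL, while (L3) needs
its STRUCTURE: `Gn = χ_s(m₀)·c_N·L_F(2s+1)·L_{E∕F}(2s)·N₃`, `N₃ s h = Σ_{a∈R(h)} μ(𝔭^{m(h)})·conj ψ(σa)·N₂ s (φ(w₂)φ(u(ι(a)δ))·h)` (★ `exists_twisted_family`'s witness — the STABLE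
TRUNCATION of the rank-one `ψ_σ`-Whittaker integral, a FINITE LINEAR FORM in the two-step family `N₂ s`: at `s = ½` the whole-line integral does not converge, the finite sum is
the honest value), and B2a's conclusion «the two-step family dies at `½`» must be about THE SAME witness `N₂` that the Siegel face is presented over.  So this file re-runs ★ (K1a-3)'s
chain ONCE and EXPORTS `(A, N₁, N₂, N₃, κ)` with (i) regularity, (ii) holomorphy of `κ·N₃(·)h` on `{0<re}`, (iii) the reading at `w_Δ` (Levi shift done), (iv) the twisted stage by
value + (iv′) THE KERNEL CLAUSE `N₂(s₀) ≡ 0 ⇒ N₃(s₀) ≡ 0`, (v) the untwisted stage identities of `N₁`, `N₂` (so ★ B7's Siegel-face chain runs over the same `N₂`).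
* §1 `exists_twisted_family_kernel` — ★ (K1a-3)-S `K2LiuRankOneStageTwisted.exists_twisted_family` (group-abstract) with ONE more conjunct exported from its explicit witness:
  `(∀ g′, Φ s₀ g′ = 0) → N s₀ g = 0` (`Finset.sum_eq_zero`); same proof, same letters.
* §2 **`exists_twoStep_reading_of_forall_eq`** — the structured local reading (i)–(v) at a non-split place (ONE place `w ∣ v`, inert or ramified: bad places included).
[KudlaRallis1994, §2] [Casselman1980, §3 Thm. 3.1] [CasselmanShalika1980, §2] [KudlaSweet1997, §1] [GanTakeda2011SiegelWeil, §7 Prop. 7.2].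
HONEST LABEL.  Count-neutral helper; `HC_CM` is proved only modulo the 7 printed citations (2 remaining named inputs: hLiu418 = `stmt-HodgeConjecture-24832`,
h413 = `stmt-HodgeConjecture-24833`) until rung 0 closes; U1-glob stays OPEN: (L3) = (iv′) ∘ B2a′ (K2E3-p06 (g6), in census), B3∕B4∕B5 (K2E3-p14).

## References
* [KudlaRallis1994] S. Kudla, S. Rallis, *A regularized Siegel–Weil formula: the first term identity*, Ann. of Math. 140 (1994), §2.
* [Casselman1980] W. Casselman, Compositio Math. 40 (1980), §3 Thm. 3.1.   * [CasselmanShalika1980] W. Casselman, J. Shalika, Compositio Math. 41 (1980), §2.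
* [KudlaSweet1997] S. Kudla, W. J. Sweet, Israel J. Math. 98 (1997), §1.   * [GanTakeda2011SiegelWeil] W. T. Gan, S. Takeda (2011), §7 Prop. 7.2, Lemma 7.4.
-/

set_option autoImplicit false
set_option linter.dupNamespace false -- the mandated namespace repeats `HodgeConjecture.HodgeConjecture`

noncomputable section

open scoped Classical NNReal ENNReal ComplexConjugate
open NumberField IsDedekindDomain Matrix MeasureTheory Topology
open Literature.NumberTheory.GaloisRepresentations.IsNonarchimedeanLocalField
open Literature.NumberTheory.Automorphic Literature.NumberTheory.Automorphic.UnitaryGroup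
open Literature.NumberTheory.GelbartRogawski1991.AdaptedBlocks
open Literature.NumberTheory.GelbartRogawski1991.UnitaryDualPair.LocalSplitting
open Literature.NumberTheory.K2Lit.LocalSiegelDoubled
open Summit.HodgeConjecture.HodgeConjecture.Cruxes.HLiu418.K2LiuQRationalDefs
open Summit.HodgeConjecture.HodgeConjecture.Cruxes.HLiu418.K2LiuQRationalLFactor
open Summit.HodgeConjecture.HodgeConjecture.Cruxes.HLiu418.K2LiuLocalLFactorDefs
open Summit.HodgeConjecture.HodgeConjecture.Cruxes.HLiu418.K2LiuLocalSiegelIwasawaFrame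
open Summit.HodgeConjecture.HodgeConjecture.Cruxes.HLiu418.K2LiuLocalSiegelIwasawa
open Summit.HodgeConjecture.HodgeConjecture.Cruxes.HLiu418.K2LiuDoubledUTwoTwoBorelFrame
open Summit.HodgeConjecture.HodgeConjecture.Cruxes.HLiu418.K2LiuDoubledUTwoTwoWeylCocycle
open Summit.HodgeConjecture.HodgeConjecture.Cruxes.HLiu418.K2LiuDoubledUTwoTwoLevi
open Summit.HodgeConjecture.HodgeConjecture.Cruxes.HLiu418.K2LiuDoubledUTwoTwoFrameTransport
open Summit.HodgeConjecture.HodgeConjecture.Cruxes.HLiu418.K2LiuDoubledUTwoTwoUnipotentCoordinates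
open Summit.HodgeConjecture.HodgeConjecture.Cruxes.HLiu418.K2LiuDoubledUTwoTwoUnipotentHaar
open Summit.HodgeConjecture.HodgeConjecture.Cruxes.HLiu418.K2LiuDoubledUTwoTwoLeviTransport
open Summit.HodgeConjecture.HodgeConjecture.Cruxes.HLiu418.K2LiuUnipDeltaRankOneCoordinates
open Summit.HodgeConjecture.HodgeConjecture.Cruxes.HLiu418.K2LiuSiegelCocycleLetters
open Summit.HodgeConjecture.HodgeConjecture.Cruxes.HLiu418.K2LiuSiegelCocycleStageLetters
open Summit.HodgeConjecture.HodgeConjecture.Cruxes.HLiu418.K2LiuSiegelCocycleStageShort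
open Summit.HodgeConjecture.HodgeConjecture.Cruxes.HLiu418.K2LiuSiegelCocycleChainShort
open Summit.HodgeConjecture.HodgeConjecture.Cruxes.HLiu418.K2LiuSiegelCocycleChainLong
open Summit.HodgeConjecture.HodgeConjecture.Cruxes.HLiu418.K2LiuIteratedRankOneCocycle
open Summit.HodgeConjecture.HodgeConjecture.Cruxes.HLiu418.K2LiuSiegelIntertwiningCocycle
open Summit.HodgeConjecture.HodgeConjecture.Cruxes.HLiu418.K2LiuRankOneStage
open Summit.HodgeConjecture.HodgeConjecture.Cruxes.HLiu418.K2LiuRankOneStageTwisted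
open Summit.HodgeConjecture.HodgeConjecture.Cruxes.HLiu418.K2LiuFlatSiegelFamilies
open Summit.HodgeConjecture.HodgeConjecture.Cruxes.HLiu418.K2LiuLocalRingPlaceDecomposition
open Summit.HodgeConjecture.HodgeConjecture.Cruxes.HLiu418.K2LiuA7NormalisedRegularitySetup
open Summit.HodgeConjecture.HodgeConjecture.Cruxes.HLiu418.K2LiuA7NormalisedRegularityMajorant
open Summit.HodgeConjecture.HodgeConjecture.Cruxes.HLiu418.K2LiuA7NormalisedRegularityAllS0
open Summit.HodgeConjecture.HodgeConjecture.Cruxes.HLiu418.K2LiuRankOneSingularLocalRegularity (integral_weight_comp_eq_iterated)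
open Summit.HodgeConjecture.HodgeConjecture.Cruxes.HLiu418.K2LiuBigCellContinuationPointLetters (differentiableOn_re_pos_of_forall_isQRationalRegularAt)
open Summit.HodgeConjecture.HodgeConjecture.Cruxes.HLiu418.K2LiuRankOneOperators
open Summit.HodgeConjecture.HodgeConjecture.Cruxes.HLiu418.K2LiuRankOneLevelShells
open Summit.HodgeConjecture.HodgeConjecture.Cruxes.HLiu418.K2LiuRankOneLevelHolomorphy

namespace Summit.HodgeConjecture.HodgeConjecture.Cruxes.HLiu418.K2LiuSingularWhittakerLocalReading

/-! ## §1 The twisted rank-one stage of a family, with its kernel clause exported -/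

section Family

variable {K : Type} [Field K] [NumberField K] {w : HeightOneSpectrum (𝓞 K)} {G : Type*} [Group G] [TopologicalSpace G] [IsTopologicalGroup G]
variable [MeasurableSpace (w.adicCompletion K)] [BorelSpace (w.adicCompletion K)] (μ : Measure (w.adicCompletion K)) [μ.IsAddHaarMeasure]

/-- **THE TWISTED RANK-ONE STAGE OF A FAMILY, WITH ITS KERNEL** — ★ (K1a-3)-S `K2LiuRankOneStageTwisted.exists_twisted_family` VERBATIM (letters of ★ B7-S: `Φ`, `K′`, `hΦK`,
`u ū hu hu0 hū hū0 hu_add w₀`, `ν hν`, `a c he C₀`, `hrel` on `1 < re s`; `ψ` of conductor exponent `mψ`, `σ ≠ 0`; explicit witness `N s g = Σ_{a∈R(g)} μ(𝔭^{m(g)})·conj ψ(σa)·Φ_s(w₀u(a)g)`)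
with ONE MORE CONJUNCT read off the witness: **`(∀ g′, Φ s₀ g′ = 0) → N s₀ g = 0`** — a finite linear form in `Φ_{s₀}` dies with `Φ_{s₀}` (the socket for U1-glob's tower step).
[cite: Casselman1980, §3 Thm. 3.1] [cite: CasselmanShalika1980, §2] [cite: KudlaRallis1994, §2] -/
theorem exists_twisted_family_kernel (Φ : ℂ → G → ℂ) {K' : Subgroup G} (hK' : IsOpen (K' : Set G))
    (hΦK : ∀ s : ℂ, 1 < s.re → ∀ g, ∀ k ∈ K', Φ s (g * k) = Φ s g)
    {u ū : w.adicCompletion K → G} (hu : Continuous u) (hu0 : u 0 = 1) (hū : Continuous ū) (hū0 : ū 0 = 1) (hu_add : ∀ x t, u (x + t) = u x * u t) (w₀ : G)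
    (ν : (w.adicCompletion K)ˣ →* ℂˣ) (hν : ∀ x, ‖((ν x : ℂˣ) : ℂ)‖ = 1) (a : ℕ) (c : ℂ) (he : ∀ s : ℂ, 1 < s.re → 1 < ((a : ℂ) * s + c).re)
    (C₀ : ℂ → ℂ)
    (hrel : ∀ s : ℂ, 1 < s.re → ∀ (x : (w.adicCompletion K)ˣ) (g : G),
      Φ s (w₀ * u x * g) = C₀ s * (((ν x)⁻¹ : ℂˣ) : ℂ) * ((normAbs (w.adicCompletion K) (x : w.adicCompletion K) : ℝ) : ℂ) ^ (-((a : ℂ) * s + c)) *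
        Φ s (ū ((x⁻¹ : (w.adicCompletion K)ˣ) : w.adicCompletion K) * g))
    (ψ : AddChar (w.adicCompletion K) Circle) {mψ : ℤ} (hmψ : ψ.HasConductorExp mψ) {σ : w.adicCompletion K} (hσ : σ ≠ 0) :
    ∃ N : ℂ → G → ℂ,
      (∀ (q₀ : ℕ) (s₀ : ℂ) (g : G), (∀ g' : G, IsQRationalRegularAt q₀ s₀ fun s => Φ s g') → IsQRationalRegularAt q₀ s₀ fun s => N s g) ∧
      (∀ (s₀ : ℂ) (g : G), (∀ g' : G, Φ s₀ g' = 0) → N s₀ g = 0) ∧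
      ∀ s : ℂ, 1 < s.re → ∀ g,
        Integrable (fun x => conj ((ψ (σ * x) : ℂ)) * Φ s (w₀ * u x * g)) μ ∧
          ∫ x, conj ((ψ (σ * x) : ℂ)) * Φ s (w₀ * u x * g) ∂μ = N s g := by
  have hq0 : (0 : ℝ≥0) < (residueFieldCard (w.adicCompletion K) : ℝ≥0)⁻¹ := inv_residueFieldCard_pos
  -- `‖σ‖ = (q⁻¹)^j`
  obtain ⟨j, hj⟩ := exists_normAbs_eq_inv_zpow hσ
  -- the level at each point, chosen once
  choose m₀ hmu hmū using fun g => exists_level₂ u ū hu hu0 hū hū0 K' hK' g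
  -- the coset level: past the level, past the HEAD threshold `mψ − j`, past the TAIL threshold `j − mψ + 2 m₀ + 1`
  let m : G → ℕ := fun g => max (m₀ g) (max (mψ - j).toNat (j - mψ + 2 * (m₀ g) + 1).toNat)
  have hm₀m : ∀ g, m₀ g ≤ m g := fun g => le_max_left _ _
  have hmhead : ∀ g, mψ - j ≤ (m g : ℤ) := fun g => by
    have h1 : ((mψ - j).toNat : ℤ) ≤ (m g : ℤ) := by exact_mod_cast (le_max_left _ _).trans (le_max_right (m₀ g) _)
    exact (Int.self_le_toNat _).trans h1
  have hmtail : ∀ g, j - mψ + 2 * (m₀ g : ℤ) + 1 ≤ (m g : ℤ) := fun g => by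
    have h1 : ((j - mψ + 2 * (m₀ g : ℤ) + 1).toNat : ℤ) ≤ (m g : ℤ) := by
      exact_mod_cast (le_max_right _ _).trans (le_max_right (m₀ g) _)
    exact (Int.self_le_toNat _).trans h1
  -- representatives of `𝔭^{-m(g)} ⧸ 𝔭^{m(g)}`
  have hR : ∀ g : G, ∃ R : Finset (w.adicCompletion K),
      (∀ a₁ ∈ R, ∀ a₂ ∈ R, a₁ ≠ a₂ → a₁ - a₂ ∉ primePowBall (w.adicCompletion K) (m g : ℤ)) ∧
      primePowBall (w.adicCompletion K) (-(m g : ℤ)) = ⋃ a₁ ∈ R, {x | x - a₁ ∈ primePowBall (w.adicCompletion K) (m g : ℤ)} := fun g => by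
    obtain ⟨R, -, hRinc, hRcov⟩ := exists_finset_primePowBall_eq_biUnion (F := w.adicCompletion K) (j := -(m g : ℤ)) (r := (m g : ℤ)) (by omega)
    exact ⟨R, hRinc, hRcov⟩
  choose R hRinc hRcov using hR
  -- the two thresholds
  have hσm : ∀ g, ∀ t ∈ primePowBall (w.adicCompletion K) (m g : ℤ), ψ (σ * t) = 1 := fun g t ht => by
    refine hmψ.1 _ ((mul_mem_primePowBall_iff hj).2 (primePowBall_antitone ?_ ht))
    linarith [hmhead g]
  have htail : ∀ g, ∃ t₀ ∈ primePowBall (w.adicCompletion K) (2 * (m₀ g : ℤ) - m g), ψ (σ * t₀) ≠ 1 := fun g => by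
    have hσout : σ ∉ primePowBall (w.adicCompletion K) (mψ - (2 * (m₀ g : ℤ) - m g)) := by
      rw [mem_primePowBall_iff, hj, not_le]
      exact (zpow_lt_zpow_iff_right_of_lt_one₀ hq0 inv_residueFieldCard_lt_one).2 (by linarith [hmtail g])
    obtain ⟨t₀, ht₀, hne⟩ := exists_mem_primePowBall_addChar_mul_ne_one hmψ hσout
    exact ⟨t₀, ht₀, by rwa [mul_comm] at hne⟩
  refine ⟨fun s g => ∑ a₁ ∈ R g, (μ.real (primePowBall (w.adicCompletion K) (m g : ℤ)) : ℂ) * (conj ((ψ (σ * a₁) : ℂ)) * Φ s (w₀ * u a₁ * g)),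
    fun q₀ s₀ g hreg => ?_, fun s₀ g h0 => ?_, fun s hs g => ?_⟩
  · exact IsQRationalRegularAt.sum (R g) fun a₁ _ => ((hreg (w₀ * u a₁ * g)).const_mul _).const_mul _
  · exact Finset.sum_eq_zero fun a₁ _ => by rw [h0, mul_zero, mul_zero]
  · have hint₀ : Integrable (fun x => Φ s (w₀ * u x * g)) μ :=
      integrable_of_letters μ hK' (hΦK s hs) hu hu0 hū hū0 hu_add w₀ ν hν _ (C₀ s) (he s hs) (hrel s hs) g
    exact integrable_and_integral_eq_twisted μ (hΦK s hs) hu_add w₀ ν _ (C₀ s) (hrel s hs) ψ σ g (m₀ g) (m g) (hm₀m g)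
      (hmu g) (hmū g) hint₀ (hσm g) (htail g) (R g) (hRinc g) (hRcov g)

end Family


/-! ## §2 The structured local reading at a non-split place -/

variable (F : Type) [Field F] [NumberField F] (E : Type) [Field E] [NumberField E] [Algebra F E]
  [Algebra.IsQuadraticExtension F E] (c : E ≃ₐ[F] E)
  {δ : E} (hcδ : c δ = -δ) (hδ : δ ≠ 0) {d : F} (hd : δ * δ = algebraMap F E d) (v : HeightOneSpectrum (𝓞 F))
  {T₂ : Matrix (Fin 2) (Fin 2) F} (hT₂ : T₂.IsSymm) {J₂D : Matrix (Fin (2 + 2)) (Fin (2 + 2)) E} (hJ₂D : J₂D = (gramD F 2 T₂).map (algebraMap F E))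
  (D Dinv : Matrix (Fin 2) (Fin 2) F) (hDD : D * Dinv = 1) (hDD' : Dinv * D = 1) (Q : GL (Fin (2 + 2)) F)
  (hQm : (Q : Matrix (Fin (2 + 2)) (Fin (2 + 2)) F) = Matrix.reindex (e₂ 2) (e₂ 2) (Matrix.fromBlocks 1 D 1 (-D)))
  (hQ : (Q : Matrix (Fin (2 + 2)) (Fin (2 + 2)) F)ᵀ * gramD F 2 T₂ * (Q : Matrix (Fin (2 + 2)) (Fin (2 + 2)) F) = (StdForm.antidiagonal (2 + 2)).over F)

include hcδ hδ hd hT₂ hDD hQm hQ in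
set_option maxHeartbeats 400000 in -- the binder telescope of the chain (as ★ (K1a-2) §1 ∕ ★ F-GK-2 §2: `whnf` > 200 000); structural `rw`∕`exact` only
/-- **THE STRUCTURED LOCAL READING OF THE SINGULAR WHITTAKER FUNCTIONAL AT A NON-SPLIT PLACE** (★ (K1a-3) `twistedRankOneRegularity_of_forall_eq`'s chain re-run ONCE with its
witnesses EXPORTED; binders verbatim + the two additive Haar measures `μF`, `μw` as inputs).  There are the Levi letter `A` (`P_w`), the NORMALISED stage families `N₁` (long root,
numerator `L_F(2s+1, χ_F)`) and `N₂` (THE TWO-STEP FAMILY: short root on top, numerator `L_{E_w}(2s, χ_F∘N)`), the TWISTED STAGE `N₃` (the stable truncation of the rank-one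
`ψ_σ`-Whittaker functional of `N₂`: a FINITE linear form in `N₂ s`) and the scalar `κ(s) = χ_s(m₀)·c_N·L_F(2s+1,χ_F)·L_{E∕F}(2s,χ_F∘N)` with: (i) `N₂`, `N₃` `q_v^{-s}`-rational and
regular at EVERY `s₀`, `κ` at every `s₀` with `0 < re s₀`; (ii) `s ↦ κ(s)·N₃ s h` holomorphic on `{0 < re}` (p28's `hFn` with **`Fn := κ·N₃`**); (iii) THE READING on `1 < re s`, head on
`w_Δ·u·h` (Levi shift done): `∫ u, conj ψ(σ·(e.symm u).1)·f_s(w_Δ u h) dν_N = κ(s)·N₃ s h`; (iv) the twisted stage BY VALUE on `1 < re s`: `∫ x, conj ψ(σx)·N₂ s (φ(w₂)φ(u(ι(x)δ))h) dμ_F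
= N₃ s h` (integrable); (iv′) THE KERNEL CLAUSE `(∀ g, N₂ s₀ g = 0) → ∀ h, N₃ s₀ h = 0` — the socket U1-glob's tower step (★ B2a-core + B2a′) pays into ON THIS `N₂` (then `Fn(½) = κ(½)·0
= 0` = ★ B1's `hFn0`); (v) the UNtwisted stage identities `N₁ s = L_F(2s+1)⁻¹·∫_y f_s(φ(w₂)φ(u(ι(y)δ))·)`, `N₂ s = L_{E_w}(2s)⁻¹·∫_ζ N₁ s (φ(P_w)φ(u₋(1_wζ))·)` on `1 < re s`, so the
Siegel face (★ B7's chain ∕ ★ B4d-3) is presented over THE SAME witness `N₂` — one `obtain`, two presentations, else nothing transfers (desk K2E3-p14 (g9) «=» 23:12:19Z); (vi) `κ` BY VALUE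
(`∃ c_N > 0`, the Haar scalar of ★ B4d-3 `exists_measure_eq_smul_map` for `(νN, μF, μw)`).
[cite: KudlaRallis1994, §2] [cite: Casselman1980, §3 Thm. 3.1] [cite: CasselmanShalika1980, §2] [cite: KudlaSweet1997, §1] [cite: GanTakeda2011SiegelWeil, §7 Prop. 7.2] -/
theorem exists_twoStep_reading_of_forall_eq
    [MeasurableSpace (unipDeltaLocal F E c v 2 (JD := J₂D))] [BorelSpace (unipDeltaLocal F E c v 2 (JD := J₂D))]
    (νN : Measure (unipDeltaLocal F E c v 2 (JD := J₂D))) [νN.IsHaarMeasure]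
    [MeasurableSpace (v.adicCompletion F)] [BorelSpace (v.adicCompletion F)] (μF : Measure (v.adicCompletion F)) [μF.IsAddHaarMeasure]
    (χv : ∀ w : PlacesOver E v, (w.1.adicCompletion E)ˣ →* ℂˣ) (hχ : ∀ (w' : PlacesOver E v) (x : (w'.1.adicCompletion E)ˣ), ‖((χv w' x : ℂˣ) : ℂ)‖ = 1)
    (K₀ : Subgroup (UnitaryGroup.localPi E c (2 + 2) J₂D v))
    (hK₀ : IsCompact (K₀ : Set (UnitaryGroup.localPi E c (2 + 2) J₂D v)) ∧ IsOpen (K₀ : Set (UnitaryGroup.localPi E c (2 + 2) J₂D v)))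
    (hIw : ∀ g : UnitaryGroup.localPi E c (2 + 2) J₂D v, ∃ p, IsSiegelDelta F E c hcδ hδ hd v 2 hT₂ hJ₂D p ∧ ∃ k ∈ K₀, g = p * k)
    (f : ℂ → UnitaryGroup.localPi E c (2 + 2) J₂D v → ℂ) (hSieg : ∀ s, IsLocalSiegelSection F E c hcδ hδ hd v 2 hT₂ hJ₂D χv s (f s)) (hsm : ∀ s, IsSmooth F E c v 2 (f s))
    (hflat : ∀ s s' : ℂ, ∀ k ∈ K₀, f s k = f s' k)
    (e3 : (v.adicCompletion F × UnitaryGroup.LocalRing E v × v.adicCompletion F) ≃ₜ unipDeltaLocal F E c v 2 (JD := J₂D))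
    (he3 : ∀ b₁ z b₂, ((e3 (b₁, z, b₂) : unipDeltaLocal F E c v 2 (JD := J₂D)) : UnitaryGroup.localPi E c (2 + 2) J₂D v) =
      FrameTransport.frameConj F E c v (2 + 2) hJ₂D (antidiagonal_over_eq_map F E 2) Q hQ
        (toLocalFour F E c v (nSiegel (UnitaryGroup.LocalRing E v) (UnitaryGroup.conjLocal E c v) (UnitaryGroup.conjLocal_conjLocal c v hcδ hδ)
          (UnitaryGroup.toLocalRing E v b₁ * algebraMap E (UnitaryGroup.LocalRing E v) δ) z
          (UnitaryGroup.toLocalRing E v b₂ * algebraMap E (UnitaryGroup.LocalRing E v) δ)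
          (conjLocal_coord F E c hcδ v b₁) (conjLocal_coord F E c hcδ v b₂))))
    (he3mul : ∀ p p', e3 (p + p') = e3 p * e3 p')
    (ψ : AddChar (v.adicCompletion F) Circle) (hψ : Continuous ψ) {mψ : ℤ} (hmψ : ψ.HasConductorExp mψ) {σ : v.adicCompletion F} (hσ : σ ≠ 0)
    (w : PlacesOver E v) (hw : ∀ w' : PlacesOver E v, w' = w)
    [MeasurableSpace (w.1.adicCompletion E)] [BorelSpace (w.1.adicCompletion E)] (μw : Measure (w.1.adicCompletion E)) [μw.IsAddHaarMeasure] :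
    ∃ (A : GL (Fin 2) (UnitaryGroup.LocalRing E v)) (N₁ N₂ N₃ : ℂ → UnitaryGroup.localPi E c (2 + 2) J₂D v → ℂ) (κ : ℂ → ℂ),
      A.val = !![1 - Pi.single w 1, Pi.single w 1; Pi.single w 1, 1 - Pi.single w 1] ∧
      (∀ (s₀ : ℂ) (g : UnitaryGroup.localPi E c (2 + 2) J₂D v), IsQRationalRegularAt (residueFieldCard (v.adicCompletion F)) s₀ fun s => N₂ s g) ∧
      (∀ (s₀ : ℂ) (g : UnitaryGroup.localPi E c (2 + 2) J₂D v), IsQRationalRegularAt (residueFieldCard (v.adicCompletion F)) s₀ fun s => N₃ s g) ∧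
      (∀ s₀ : ℂ, 0 < s₀.re → IsQRationalRegularAt (residueFieldCard (v.adicCompletion F)) s₀ κ) ∧
      (∀ h : UnitaryGroup.localPi E c (2 + 2) J₂D v, DifferentiableOn ℂ (fun s => κ s * N₃ s h) {s : ℂ | 0 < s.re}) ∧
      (∀ s : ℂ, 1 < s.re → ∀ h : UnitaryGroup.localPi E c (2 + 2) J₂D v,
        ∫ u, conj ((ψ (σ * (e3.symm u).1) : ℂ)) * f s (weylDelta F E c v 2 hJ₂D (T₀ := T₂) * (u : UnitaryGroup.localPi E c (2 + 2) J₂D v) * h) ∂νN = κ s * N₃ s h) ∧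
      (∀ s : ℂ, 1 < s.re → ∀ h : UnitaryGroup.localPi E c (2 + 2) J₂D v,
        Integrable (fun x => conj ((ψ (σ * x) : ℂ)) * N₂ s (FrameTransport.frameConj F E c v (2 + 2) hJ₂D (antidiagonal_over_eq_map F E 2) Q hQ (toLocalFour F E c v (weylTwo (UnitaryGroup.LocalRing E v) (UnitaryGroup.conjLocal E c v))) * FrameTransport.frameConj F E c v (2 + 2) hJ₂D (antidiagonal_over_eq_map F E 2) Q hQ (toLocalFour F E c v (uLongTwo (UnitaryGroup.LocalRing E v) (UnitaryGroup.conjLocal E c v) (UnitaryGroup.toLocalRing E v x * algebraMap E (UnitaryGroup.LocalRing E v) δ) (conjLocal_coord F E c hcδ v x))) * h)) μF ∧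
          ∫ x, conj ((ψ (σ * x) : ℂ)) * N₂ s (FrameTransport.frameConj F E c v (2 + 2) hJ₂D (antidiagonal_over_eq_map F E 2) Q hQ (toLocalFour F E c v (weylTwo (UnitaryGroup.LocalRing E v) (UnitaryGroup.conjLocal E c v))) * FrameTransport.frameConj F E c v (2 + 2) hJ₂D (antidiagonal_over_eq_map F E 2) Q hQ (toLocalFour F E c v (uLongTwo (UnitaryGroup.LocalRing E v) (UnitaryGroup.conjLocal E c v) (UnitaryGroup.toLocalRing E v x * algebraMap E (UnitaryGroup.LocalRing E v) δ) (conjLocal_coord F E c hcδ v x))) * h) ∂μF = N₃ s h) ∧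
      (∀ s₀ : ℂ, (∀ g : UnitaryGroup.localPi E c (2 + 2) J₂D v, N₂ s₀ g = 0) → ∀ h : UnitaryGroup.localPi E c (2 + 2) J₂D v, N₃ s₀ h = 0) ∧
      (∀ s : ℂ, 1 < s.re →
        (∀ g : UnitaryGroup.localPi E c (2 + 2) J₂D v, N₁ s g = (lF F E v χv (2 * s + 1))⁻¹ * ∫ y, f s (FrameTransport.frameConj F E c v (2 + 2) hJ₂D (antidiagonal_over_eq_map F E 2) Q hQ (toLocalFour F E c v (weylTwo (UnitaryGroup.LocalRing E v) (UnitaryGroup.conjLocal E c v))) * FrameTransport.frameConj F E c v (2 + 2) hJ₂D (antidiagonal_over_eq_map F E 2) Q hQ (toLocalFour F E c v (uLongTwo (UnitaryGroup.LocalRing E v) (UnitaryGroup.conjLocal E c v) (UnitaryGroup.toLocalRing E v y * algebraMap E (UnitaryGroup.LocalRing E v) δ) (conjLocal_coord F E c hcδ v y))) * g) ∂μF) ∧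
        (∀ g : UnitaryGroup.localPi E c (2 + 2) J₂D v, N₂ s g = (lEN F E c v χv (2 * s))⁻¹ * ∫ ζ, N₁ s (FrameTransport.frameConj F E c v (2 + 2) hJ₂D (antidiagonal_over_eq_map F E 2) Q hQ (toLocalFour F E c v (leviElt (UnitaryGroup.LocalRing E v) (UnitaryGroup.conjLocal E c v) (UnitaryGroup.conjLocal_conjLocal c v hcδ hδ) A)) * FrameTransport.frameConj F E c v (2 + 2) hJ₂D (antidiagonal_over_eq_map F E 2) Q hQ (toLocalFour F E c v (uMinus (UnitaryGroup.LocalRing E v) (UnitaryGroup.conjLocal E c v) (UnitaryGroup.conjLocal_conjLocal c v hcδ hδ) (Pi.single w ζ))) * g) ∂μw)) ∧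
      (∃ cN : ℝ≥0, 0 < cN ∧ ∀ s : ℂ, κ s = localSiegelCharacter F E c v 2 χv s (weylDelta F E c v 2 hJ₂D (T₀ := T₂) * FrameTransport.frameConj F E c v (2 + 2) hJ₂D (antidiagonal_over_eq_map F E 2) Q hQ (toLocalFour F E c v (weylSiegel (UnitaryGroup.LocalRing E v) (UnitaryGroup.conjLocal E c v)))) * (((cN : ℝ) : ℂ) * (lF F E v χv (2 * s + 1) * lEN F E c v χv (2 * s)))) := by
  -- topology and measures on `F_v`, `E_w`, `E ⊗ F_v`
  haveI := secondCountableTopology_adicCompletion F v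
  haveI : ∀ w' : PlacesOver E v, SecondCountableTopology (w'.1.adicCompletion E) := fun w' => secondCountableTopology_adicCompletion E w'.1
  borelize (UnitaryGroup.LocalRing E v)
  obtain ⟨e₁, he₁, he₁add⟩ := exists_homeomorph_single_of_forall_eq F E v w hw
  have hmap : Measure.map (⇑e₁) μw = Measure.map (⇑e₁.toMeasurableEquiv) μw := by rw [Homeomorph.toMeasurableEquiv_coe]
  haveI hμR : (Measure.map (⇑e₁) μw).IsAddHaarMeasure :=
    AddEquiv.isAddHaarMeasure_map μw ({ toFun := e₁, invFun := e₁.symm, left_inv := e₁.symm_apply_apply, right_inv := e₁.apply_symm_apply, map_add' := he₁add } :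
      w.1.adicCompletion E ≃+ UnitaryGroup.LocalRing E v) e₁.continuous e₁.symm.continuous
  have hμRint : ∀ G : UnitaryGroup.LocalRing E v → ℂ, ∫ z, G z ∂(Measure.map (⇑e₁) μw) = ∫ ζ, G (Pi.single w ζ) ∂μw := fun G => by
    rw [hmap, integral_map_equiv]; simp only [Homeomorph.toMeasurableEquiv_coe, he₁]
  -- the coordinates of `N_Δ(F_v)` and the Haar relation
  obtain ⟨cN, hcN, hν⟩ := exists_measure_eq_smul_map F E c v e3 he3mul νN μF (Measure.map (⇑e₁) μw)
  -- one level for the whole family, regular values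
  obtain ⟨K', -, hK'⟩ := exists_uniform_level F E c hcδ hδ hd v 2 hT₂ hJ₂D χv hSieg hflat hK₀.2 hIw (hsm 0)
  have hreg0 : ∀ (s₀ : ℂ) (h), IsQRationalRegularAt (residueFieldCard (v.adicCompletion F)) s₀ fun s => f s h := fun s₀ h =>
    isQRationalRegularAt_apply_of_flat F E c hcδ hδ hd v 2 hT₂ hJ₂D χv hSieg hflat hIw h s₀
  -- the letters
  obtain ⟨A, hA⟩ := exists_partialWeylGL F E v w
  have huA := continuous_frameConj_uLongTwo_coord F E c hcδ hδ v hJ₂D Q hQ e3 he3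
  have hūA := continuous_ubar F E c hcδ hδ hd v hJ₂D Q hQ e3 he3
  have huBp := continuous_frameConj_uMinus_single F E c hcδ hδ v hJ₂D Q hQ w e3 he3
  have hūBp := continuous_ubar_single F E c hcδ hδ v hJ₂D Q hQ w e3 he3 (single_one_mul_single_one F E v w) A hA
  have huBadd : ∀ ζ ζ' : w.1.adicCompletion E, FrameTransport.frameConj F E c v (2 + 2) hJ₂D (antidiagonal_over_eq_map F E 2) Q hQ (toLocalFour F E c v (uMinus (UnitaryGroup.LocalRing E v) (UnitaryGroup.conjLocal E c v) (UnitaryGroup.conjLocal_conjLocal c v hcδ hδ) (Pi.single w (ζ + ζ')))) = FrameTransport.frameConj F E c v (2 + 2) hJ₂D (antidiagonal_over_eq_map F E 2) Q hQ (toLocalFour F E c v (uMinus (UnitaryGroup.LocalRing E v) (UnitaryGroup.conjLocal E c v) (UnitaryGroup.conjLocal_conjLocal c v hcδ hδ) (Pi.single w ζ))) * FrameTransport.frameConj F E c v (2 + 2) hJ₂D (antidiagonal_over_eq_map F E 2) Q hQ (toLocalFour F E c v (uMinus (UnitaryGroup.LocalRing E v) (UnitaryGroup.conjLocal E c v) (UnitaryGroup.conjLocal_conjLocal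 c v hcδ hδ) (Pi.single w ζ'))) :=
    fun ζ ζ' => by
      rw [show uMinus (UnitaryGroup.LocalRing E v) (UnitaryGroup.conjLocal E c v) (UnitaryGroup.conjLocal_conjLocal c v hcδ hδ) (Pi.single w (ζ + ζ')) =
          uMinus (UnitaryGroup.LocalRing E v) (UnitaryGroup.conjLocal E c v) (UnitaryGroup.conjLocal_conjLocal c v hcδ hδ) (Pi.single w ζ) * uMinus (UnitaryGroup.LocalRing E v) (UnitaryGroup.conjLocal E c v) (UnitaryGroup.conjLocal_conjLocal c v hcδ hδ) (Pi.single w ζ') by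
        rw [uMinus_mul, ← Pi.single_add], map_mul, map_mul]
  have hmid : ∀ (ζ : w.1.adicCompletion E) (g : UnitaryGroup.localPi E c (2 + 2) J₂D v), FrameTransport.frameConj F E c v (2 + 2) hJ₂D (antidiagonal_over_eq_map F E 2) Q hQ (toLocalFour F E c v (weylOne (UnitaryGroup.LocalRing E v) (UnitaryGroup.conjLocal E c v))) * FrameTransport.frameConj F E c v (2 + 2) hJ₂D (antidiagonal_over_eq_map F E 2) Q hQ (toLocalFour F E c v (uMinus (UnitaryGroup.LocalRing E v) (UnitaryGroup.conjLocal E c v) (UnitaryGroup.conjLocal_conjLocal c v hcδ hδ) (Pi.single w ζ))) * g = FrameTransport.frameConj F E c v (2 + 2) hJ₂D (antidiagonal_over_eq_map F E 2) Q hQ (toLocalFour F E c v (leviElt (UnitaryGroup.LocalRing E v) (UnitaryGroup.conjLocal E c v) (UnitaryGroup.conjLocal_conjLocal c v hcδ hδ) A)) * FrameTransport.frameConj F E c v (2 + 2) hJ₂D (antidiagonal_over_eq_map F E 2) Q hQ (toLocalFour F E c v (uMinus (UnitaryGroup.LocalRing E v) (UnitaryGroup.conjLocal E c v) (UnitaryGroup.conjLocal_conjLocal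 c v hcδ hδ) (Pi.single w ζ))) * g := by
    intro ζ g
    rw [← frameConj_partialWeyl_mul_uMinus_of_forall_eq F E c hcδ hδ v hJ₂D Q hQ hw A hA (Pi.single w ζ), Pi.single_eq_same]
  -- the residue cardinalities
  have hq0 : residueFieldCard (v.adicCompletion F) ≠ 0 := residueFieldCard_ne_zero _
  have hqw := residueFieldCard_placesOver_eq_pow (F := F) (E := E) (v := v) w
  -- STAGE A: `f ↦ N₁`, numerator `L_F(2s+1, χ_F)`
  have heA : ∀ s : ℂ, 1 < s.re → 1 < (((2 : ℕ) : ℂ) * s + 2).re := fun s hs => by simp; linarith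
  obtain ⟨N₁, hN₁reg₀, hN₁⟩ := exists_normalised_family_allS0 μF f K'.isOpen (fun s _ g k hk => hK' s g k hk) huA
    (frameConj_uLongTwo_coord_zero F E c hcδ v hJ₂D Q hQ) hūA (ubar_zero F E c hcδ hδ hd v hJ₂D Q hQ) (frameConj_uLongTwo_coord_add F E c hcδ v hJ₂D Q hQ)
    (FrameTransport.frameConj F E c v (2 + 2) hJ₂D (antidiagonal_over_eq_map F E 2) Q hQ (toLocalFour F E c v (weylTwo (UnitaryGroup.LocalRing E v) (UnitaryGroup.conjLocal E c v)))) (chiF F E v χv) (norm_chiF_eq_one (F := F) (E := E) hχ) 2 2 heA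
    (fun s => localSiegelCharacter F E c v 2 χv s (FrameTransport.frameConj F E c v (2 + 2) hJ₂D (antidiagonal_over_eq_map F E 2) Q hQ (toLocalFour F E c v (torusElt (UnitaryGroup.LocalRing E v) (UnitaryGroup.conjLocal E c v) (UnitaryGroup.conjLocal_conjLocal c v hcδ hδ) 1 (-((Units.mk0 δ hδ).map (algebraMap E (UnitaryGroup.LocalRing E v) : E →* UnitaryGroup.LocalRing E v))⁻¹))))) (residueFieldCard (v.adicCompletion F)) 1 hq0 (pow_one _).symm
    (fun s _ x g => by simpa only [Nat.cast_ofNat] using apply_weylTwo_uLongTwo_coord_of_isLocalSiegelSection F E c hcδ hδ hd v hT₂ hJ₂D D Dinv hDD Q hQm hQ χv s (hSieg s) x g)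
  have hN₁reg : ∀ (s₀ : ℂ) (g), IsQRationalRegularAt (residueFieldCard (v.adicCompletion F)) s₀ fun s => N₁ s g := fun s₀ =>
    hN₁reg₀ s₀ (isQRationalRegularAt_localSiegelCharacter F E c hcδ hδ hd v 2 hT₂ hJ₂D χv
      (isSiegelDelta_frameConj_torusElt F E c hcδ hδ hd v hT₂ hJ₂D D Dinv hDD Q hQm hQ 1 _) s₀) (hreg0 s₀)
  have hLA : ∀ s : ℂ, 1 < s.re → lFactor F v (chiF F E v χv) (((2 : ℕ) : ℂ) * s + 2 - 1) ≠ 0 := fun s hs =>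
    lFactor_ne_zero (norm_unramValue_le_one (norm_chiF_eq_one (F := F) (E := E) hχ)) (by simp; linarith)
  have hN₁eq : ∀ s : ℂ, 1 < s.re → ∀ g, N₁ s g = (lFactor F v (chiF F E v χv) (((2 : ℕ) : ℂ) * s + 2 - 1))⁻¹ *
      ∫ y, f s (FrameTransport.frameConj F E c v (2 + 2) hJ₂D (antidiagonal_over_eq_map F E 2) Q hQ (toLocalFour F E c v (weylTwo (UnitaryGroup.LocalRing E v) (UnitaryGroup.conjLocal E c v))) * FrameTransport.frameConj F E c v (2 + 2) hJ₂D (antidiagonal_over_eq_map F E 2) Q hQ (toLocalFour F E c v (uLongTwo (UnitaryGroup.LocalRing E v) (UnitaryGroup.conjLocal E c v) (UnitaryGroup.toLocalRing E v y * algebraMap E (UnitaryGroup.LocalRing E v) δ) (conjLocal_coord F E c hcδ v y))) * g) ∂μF := fun s hs g => by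
    rw [(hN₁ s hs g).2, ← mul_assoc, inv_mul_cancel₀ (hLA s hs), one_mul]
  have hN₁K : ∀ s : ℂ, 1 < s.re → ∀ g, ∀ k ∈ (K' : Subgroup (UnitaryGroup.localPi E c (2 + 2) J₂D v)), N₁ s (g * k) = N₁ s g := fun s hs g k hk => by
    rw [hN₁eq s hs, hN₁eq s hs]
    exact congrArg _ (integral_congr_ae (Filter.Eventually.of_forall fun y => by simp only [← mul_assoc]; exact hK' s _ k hk))
  -- STAGE B: `N₁ ↦ N₂`, numerator `L_{E_w}(2s, χ_F ∘ N)`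
  have heB : ∀ s : ℂ, 1 < s.re → 1 < (((2 : ℕ) : ℂ) * s + 1).re := fun s hs => by simp; linarith
  obtain ⟨N₂, hN₂reg₀, hN₂⟩ := exists_normalised_family_allS0 μw N₁ K'.isOpen hN₁K huBp.1 huBp.2 hūBp.1 hūBp.2 huBadd
    (FrameTransport.frameConj F E c v (2 + 2) hJ₂D (antidiagonal_over_eq_map F E 2) Q hQ (toLocalFour F E c v (leviElt (UnitaryGroup.LocalRing E v) (UnitaryGroup.conjLocal E c v) (UnitaryGroup.conjLocal_conjLocal c v hcδ hδ) A))) (chiNorm F E c v χv w) (norm_chiNorm_eq_one (F := F) (E := E) (c := c) hχ w) 2 1 heB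
    (fun _ => ((χv w (-1) : ℂˣ) : ℂ)) (residueFieldCard (v.adicCompletion F)) _ hq0 hqw
    (fun s hs x g => by simpa only [Nat.cast_ofNat] using hrel_short F E c hcδ hδ hd v hT₂ hJ₂D D Dinv hDD Q hQm hQ μF χv s (hSieg s) _ (hN₁eq s hs) w A hA x g)
  have hN₂reg : ∀ (s₀ : ℂ) (g), IsQRationalRegularAt (residueFieldCard (v.adicCompletion F)) s₀ fun s => N₂ s g := fun s₀ =>
    hN₂reg₀ s₀ (isQRationalRegularAt_const _ _ _) (hN₁reg s₀)
  have hLB : ∀ s : ℂ, 1 < s.re → lFactor E w.1 (chiNorm F E c v χv w) (((2 : ℕ) : ℂ) * s + 1 - 1) ≠ 0 := fun s hs =>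
    lFactor_ne_zero (norm_unramValue_le_one (norm_chiNorm_eq_one (F := F) (E := E) (c := c) hχ w)) (by simp; linarith)
  have hN₂eq : ∀ s : ℂ, 1 < s.re → ∀ g, N₂ s g = (lFactor E w.1 (chiNorm F E c v χv w) (((2 : ℕ) : ℂ) * s + 1 - 1))⁻¹ *
      ∫ ζ, N₁ s (FrameTransport.frameConj F E c v (2 + 2) hJ₂D (antidiagonal_over_eq_map F E 2) Q hQ (toLocalFour F E c v (leviElt (UnitaryGroup.LocalRing E v) (UnitaryGroup.conjLocal E c v) (UnitaryGroup.conjLocal_conjLocal c v hcδ hδ) A)) * FrameTransport.frameConj F E c v (2 + 2) hJ₂D (antidiagonal_over_eq_map F E 2) Q hQ (toLocalFour F E c v (uMinus (UnitaryGroup.LocalRing E v) (UnitaryGroup.conjLocal E c v) (UnitaryGroup.conjLocal_conjLocal c v hcδ hδ) (Pi.single w ζ))) * g) ∂μw := fun s hs g => by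
    rw [(hN₂ s hs g).2, ← mul_assoc, inv_mul_cancel₀ (hLB s hs), one_mul]
  have hN₂K : ∀ s : ℂ, 1 < s.re → ∀ g, ∀ k ∈ (K' : Subgroup (UnitaryGroup.localPi E c (2 + 2) J₂D v)), N₂ s (g * k) = N₂ s g := fun s hs g k hk => by
    rw [hN₂eq s hs, hN₂eq s hs]
    exact congrArg _ (integral_congr_ae (Filter.Eventually.of_forall fun ζ => by simp only [← mul_assoc]; exact hN₁K s hs _ k hk))
  -- STAGE C, TWISTED: `N₂ ↦ N₃` by ★ `exists_twisted_family` — NO numerator, regular at EVERY `s₀`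
  have heC : ∀ s : ℂ, 1 < s.re → 1 < (((2 : ℕ) : ℂ) * s + 0).re := fun s hs => by simp; linarith
  obtain ⟨N₃, hN₃reg₀, hN₃ker, hN₃⟩ := exists_twisted_family_kernel μF N₂ K'.isOpen hN₂K huA
    (frameConj_uLongTwo_coord_zero F E c hcδ v hJ₂D Q hQ) hūA (ubar_zero F E c hcδ hδ hd v hJ₂D Q hQ) (frameConj_uLongTwo_coord_add F E c hcδ v hJ₂D Q hQ)
    (FrameTransport.frameConj F E c v (2 + 2) hJ₂D (antidiagonal_over_eq_map F E 2) Q hQ (toLocalFour F E c v (weylTwo (UnitaryGroup.LocalRing E v) (UnitaryGroup.conjLocal E c v)))) (chiF F E v χv) (norm_chiF_eq_one (F := F) (E := E) hχ) 2 0 heC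
    (fun s => localSiegelCharacter F E c v 2 χv s (FrameTransport.frameConj F E c v (2 + 2) hJ₂D (antidiagonal_over_eq_map F E 2) Q hQ (toLocalFour F E c v (torusElt (UnitaryGroup.LocalRing E v) (UnitaryGroup.conjLocal E c v) (UnitaryGroup.conjLocal_conjLocal c v hcδ hδ) (-((Units.mk0 δ hδ).map (algebraMap E (UnitaryGroup.LocalRing E v) : E →* UnitaryGroup.LocalRing E v))⁻¹) 1))) * ((∏ w' : PlacesOver E v, ‖algebraMap E (UnitaryGroup.LocalRing E v) δ w'‖ : ℝ) : ℂ))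
    (fun s hs x g => by
      rw [hrel_long_of_forall_eq F E c hcδ hδ hd v hT₂ hJ₂D D Dinv hDD Q hQm hQ μF χv s (hSieg s) _ (hN₁eq s hs) w hw μw A hA _ (hN₂eq s hs) x g]
      simp only [Nat.cast_ofNat, add_zero]; ring)
    ψ hmψ hσ
  have hN₃reg : ∀ (s₀ : ℂ) (g), IsQRationalRegularAt (residueFieldCard (v.adicCompletion F)) s₀ fun s => N₃ s g := fun s₀ g =>
    hN₃reg₀ _ s₀ g (hN₂reg s₀)
  -- the scalar `κ(s) = χ_s(m₀) · c_N · L_F(2s+1, χ_F) · L_{E∕F}(2s, χ_F∘N)` is regular on `0 < re s`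
  have hκreg : ∀ s₀ : ℂ, 0 < s₀.re → IsQRationalRegularAt (residueFieldCard (v.adicCompletion F)) s₀
      (fun s => localSiegelCharacter F E c v 2 χv s (weylDelta F E c v 2 hJ₂D (T₀ := T₂) * FrameTransport.frameConj F E c v (2 + 2) hJ₂D (antidiagonal_over_eq_map F E 2) Q hQ (toLocalFour F E c v (weylSiegel (UnitaryGroup.LocalRing E v) (UnitaryGroup.conjLocal E c v)))) * (((cN : ℝ) : ℂ) * (lF F E v χv (2 * s + 1) * lEN F E c v χv (2 * s)))) := by
    intro s₀ hs₀
    have h1 : IsQRationalRegularAt (residueFieldCard (v.adicCompletion F)) s₀ fun s => lF F E v χv (2 * s + 1) := by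
      have h := isQRationalRegularAt_lF_affine (v := v) hχ 2 (1 : ℂ) (s₀ := s₀)
        (by simp only [Nat.cast_ofNat, Complex.add_re, Complex.mul_re, Complex.re_ofNat, Complex.im_ofNat, Complex.one_re]; linarith)
      simpa only [Nat.cast_ofNat] using h
    have h2 : IsQRationalRegularAt (residueFieldCard (v.adicCompletion F)) s₀ fun s => lEN F E c v χv (2 * s) := by
      have h := isQRationalRegularAt_lEN_affine c (v := v) hχ 2 (0 : ℂ) (s₀ := s₀)
        (by simp only [Nat.cast_ofNat, Complex.add_re, Complex.mul_re, Complex.re_ofNat, Complex.im_ofNat, Complex.zero_re]; linarith)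
      simpa only [Nat.cast_ofNat, add_zero] using h
    exact (isQRationalRegularAt_localSiegelCharacter F E c hcδ hδ hd v 2 hT₂ hJ₂D χv
      (isSiegelDelta_weylDelta_mul_frameConj_weylSiegel F E c hcδ hδ hd v hT₂ hJ₂D D Dinv hDD Q hQm hQ) s₀).mul ((h1.mul h2).const_mul _)
  -- the frame-word reading on `1 < re s` (★ (K1a-3)'s computation, verbatim)
  have hframe : ∀ s : ℂ, 1 < s.re → ∀ h : UnitaryGroup.localPi E c (2 + 2) J₂D v,
      ∫ u, conj ((ψ (σ * (e3.symm u).1) : ℂ)) * f s (FrameTransport.frameConj F E c v (2 + 2) hJ₂D (antidiagonal_over_eq_map F E 2) Q hQ (toLocalFour F E c v (weylSiegel (UnitaryGroup.LocalRing E v) (UnitaryGroup.conjLocal E c v))) * (u : UnitaryGroup.localPi E c (2 + 2) J₂D v) * h) ∂νN =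
        ((cN : ℝ) : ℂ) * (lF F E v χv (2 * s + 1) * lEN F E c v χv (2 * s) * N₃ s h) := by
    intro s hs h
    have hs0 : 0 < s.re := by linarith
    -- the weighted iterated integral (§1 over ★ B4d-3's word and ★ B7-M2's majorant chain)
    have hch := chain_integrability_of_forall_eq F E c hcδ hδ hd v hT₂ hJ₂D D Dinv hDD Q hQm hQ μF e3 he3 hχ hs (hSieg s) (hsm s) K' (hK' s) w hw μw e₁ he₁ A hA h
    have hword : ∀ (x : v.adicCompletion F) (z : UnitaryGroup.LocalRing E v) (y : v.adicCompletion F),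
        FrameTransport.frameConj F E c v (2 + 2) hJ₂D (antidiagonal_over_eq_map F E 2) Q hQ (toLocalFour F E c v (weylSiegel (UnitaryGroup.LocalRing E v) (UnitaryGroup.conjLocal E c v))) * ((e3.toMeasurableEquiv (x, (z, y)) : unipDeltaLocal F E c v 2 (JD := J₂D)) : UnitaryGroup.localPi E c (2 + 2) J₂D v) =
          FrameTransport.frameConj F E c v (2 + 2) hJ₂D (antidiagonal_over_eq_map F E 2) Q hQ (toLocalFour F E c v (weylTwo (UnitaryGroup.LocalRing E v) (UnitaryGroup.conjLocal E c v))) * FrameTransport.frameConj F E c v (2 + 2) hJ₂D (antidiagonal_over_eq_map F E 2) Q hQ (toLocalFour F E c v (uLongTwo (UnitaryGroup.LocalRing E v) (UnitaryGroup.conjLocal E c v) (UnitaryGroup.toLocalRing E v y * algebraMap E (UnitaryGroup.LocalRing E v) δ) (conjLocal_coord F E c hcδ v y))) *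
            (FrameTransport.frameConj F E c v (2 + 2) hJ₂D (antidiagonal_over_eq_map F E 2) Q hQ (toLocalFour F E c v (weylOne (UnitaryGroup.LocalRing E v) (UnitaryGroup.conjLocal E c v))) * FrameTransport.frameConj F E c v (2 + 2) hJ₂D (antidiagonal_over_eq_map F E 2) Q hQ (toLocalFour F E c v (uMinus (UnitaryGroup.LocalRing E v) (UnitaryGroup.conjLocal E c v) (UnitaryGroup.conjLocal_conjLocal c v hcδ hδ) z))) *
            (FrameTransport.frameConj F E c v (2 + 2) hJ₂D (antidiagonal_over_eq_map F E 2) Q hQ (toLocalFour F E c v (weylTwo (UnitaryGroup.LocalRing E v) (UnitaryGroup.conjLocal E c v))) * FrameTransport.frameConj F E c v (2 + 2) hJ₂D (antidiagonal_over_eq_map F E 2) Q hQ (toLocalFour F E c v (uLongTwo (UnitaryGroup.LocalRing E v) (UnitaryGroup.conjLocal E c v) (UnitaryGroup.toLocalRing E v x * algebraMap E (UnitaryGroup.LocalRing E v) δ) (conjLocal_coord F E c hcδ v x)))) := by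
      intro x z y
      rw [Homeomorph.toMeasurableEquiv_coe, he3, frameConj_weylSiegel_mul_coord F E c hcδ hδ v hJ₂D Q hQ]
    have hπ : ∀ p : v.adicCompletion F × (UnitaryGroup.LocalRing E v × v.adicCompletion F), (e3.symm (e3.toMeasurableEquiv p)).1 = p.1 := fun p => by
      rw [Homeomorph.toMeasurableEquiv_coe, Homeomorph.symm_apply_apply]
    have hWm : Measurable fun x : v.adicCompletion F => conj ((ψ (σ * x) : ℂ)) :=
      (Complex.continuous_conj.comp (continuous_subtype_val.comp (hψ.comp (continuous_const.mul continuous_id)))).measurable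
    have hW1 : ∀ x : v.adicCompletion F, ‖conj ((ψ (σ * x) : ℂ))‖ ≤ 1 := fun x => by
      rw [Complex.norm_conj, Circle.norm_coe]
    have hint := integrable_of_iterated μF (Measure.map (⇑e₁) μw) μF
      (fun y : v.adicCompletion F => FrameTransport.frameConj F E c v (2 + 2) hJ₂D (antidiagonal_over_eq_map F E 2) Q hQ (toLocalFour F E c v (weylTwo (UnitaryGroup.LocalRing E v) (UnitaryGroup.conjLocal E c v))) * FrameTransport.frameConj F E c v (2 + 2) hJ₂D (antidiagonal_over_eq_map F E 2) Q hQ (toLocalFour F E c v (uLongTwo (UnitaryGroup.LocalRing E v) (UnitaryGroup.conjLocal E c v) (UnitaryGroup.toLocalRing E v y * algebraMap E (UnitaryGroup.LocalRing E v) δ) (conjLocal_coord F E c hcδ v y))))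
      (fun z : UnitaryGroup.LocalRing E v => FrameTransport.frameConj F E c v (2 + 2) hJ₂D (antidiagonal_over_eq_map F E 2) Q hQ (toLocalFour F E c v (weylOne (UnitaryGroup.LocalRing E v) (UnitaryGroup.conjLocal E c v))) * FrameTransport.frameConj F E c v (2 + 2) hJ₂D (antidiagonal_over_eq_map F E 2) Q hQ (toLocalFour F E c v (uMinus (UnitaryGroup.LocalRing E v) (UnitaryGroup.conjLocal E c v) (UnitaryGroup.conjLocal_conjLocal c v hcδ hδ) z)))
      (fun x : v.adicCompletion F => FrameTransport.frameConj F E c v (2 + 2) hJ₂D (antidiagonal_over_eq_map F E 2) Q hQ (toLocalFour F E c v (weylTwo (UnitaryGroup.LocalRing E v) (UnitaryGroup.conjLocal E c v))) * FrameTransport.frameConj F E c v (2 + 2) hJ₂D (antidiagonal_over_eq_map F E 2) Q hQ (toLocalFour F E c v (uLongTwo (UnitaryGroup.LocalRing E v) (UnitaryGroup.conjLocal E c v) (UnitaryGroup.toLocalRing E v x * algebraMap E (UnitaryGroup.LocalRing E v) δ) (conjLocal_coord F E c hcδ v x)))) (f s) h hch.1 hch.2.1 hch.2.2.1 hch.2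.2.2
    have hiter := (integral_weight_comp_eq_iterated νN μF (Measure.map (⇑e₁) μw) μF
      (fun u : unipDeltaLocal F E c v 2 (JD := J₂D) => (u : UnitaryGroup.localPi E c (2 + 2) J₂D v)) e3.toMeasurableEquiv (cN : ℝ≥0∞)
      (FrameTransport.frameConj F E c v (2 + 2) hJ₂D (antidiagonal_over_eq_map F E 2) Q hQ (toLocalFour F E c v (weylSiegel (UnitaryGroup.LocalRing E v) (UnitaryGroup.conjLocal E c v))))
      (fun y : v.adicCompletion F => FrameTransport.frameConj F E c v (2 + 2) hJ₂D (antidiagonal_over_eq_map F E 2) Q hQ (toLocalFour F E c v (weylTwo (UnitaryGroup.LocalRing E v) (UnitaryGroup.conjLocal E c v))) * FrameTransport.frameConj F E c v (2 + 2) hJ₂D (antidiagonal_over_eq_map F E 2) Q hQ (toLocalFour F E c v (uLongTwo (UnitaryGroup.LocalRing E v) (UnitaryGroup.conjLocal E c v) (UnitaryGroup.toLocalRing E v y * algebraMap E (UnitaryGroup.LocalRing E v) δ) (conjLocal_coord F E c hcδ v y))))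
      (fun z : UnitaryGroup.LocalRing E v => FrameTransport.frameConj F E c v (2 + 2) hJ₂D (antidiagonal_over_eq_map F E 2) Q hQ (toLocalFour F E c v (weylOne (UnitaryGroup.LocalRing E v) (UnitaryGroup.conjLocal E c v))) * FrameTransport.frameConj F E c v (2 + 2) hJ₂D (antidiagonal_over_eq_map F E 2) Q hQ (toLocalFour F E c v (uMinus (UnitaryGroup.LocalRing E v) (UnitaryGroup.conjLocal E c v) (UnitaryGroup.conjLocal_conjLocal c v hcδ hδ) z)))
      (fun x : v.adicCompletion F => FrameTransport.frameConj F E c v (2 + 2) hJ₂D (antidiagonal_over_eq_map F E 2) Q hQ (toLocalFour F E c v (weylTwo (UnitaryGroup.LocalRing E v) (UnitaryGroup.conjLocal E c v))) * FrameTransport.frameConj F E c v (2 + 2) hJ₂D (antidiagonal_over_eq_map F E 2) Q hQ (toLocalFour F E c v (uLongTwo (UnitaryGroup.LocalRing E v) (UnitaryGroup.conjLocal E c v) (UnitaryGroup.toLocalRing E v x * algebraMap E (UnitaryGroup.LocalRing E v) δ) (conjLocal_coord F E c hcδ v x))))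
      hν ENNReal.coe_ne_top hword (fun u => (e3.symm u).1) hπ (f s) h (fun x => conj ((ψ (σ * x) : ℂ))) hWm hW1 hint).2
    rw [ENNReal.coe_toReal] at hiter
    rw [hiter]
    -- evaluate the three stages
    have inner : ∀ (x : v.adicCompletion F) (z : UnitaryGroup.LocalRing E v),
        ∫ y, f s (FrameTransport.frameConj F E c v (2 + 2) hJ₂D (antidiagonal_over_eq_map F E 2) Q hQ (toLocalFour F E c v (weylTwo (UnitaryGroup.LocalRing E v) (UnitaryGroup.conjLocal E c v))) * FrameTransport.frameConj F E c v (2 + 2) hJ₂D (antidiagonal_over_eq_map F E 2) Q hQ (toLocalFour F E c v (uLongTwo (UnitaryGroup.LocalRing E v) (UnitaryGroup.conjLocal E c v) (UnitaryGroup.toLocalRing E v y * algebraMap E (UnitaryGroup.LocalRing E v) δ) (conjLocal_coord F E c hcδ v y))) *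
              (FrameTransport.frameConj F E c v (2 + 2) hJ₂D (antidiagonal_over_eq_map F E 2) Q hQ (toLocalFour F E c v (weylOne (UnitaryGroup.LocalRing E v) (UnitaryGroup.conjLocal E c v))) * FrameTransport.frameConj F E c v (2 + 2) hJ₂D (antidiagonal_over_eq_map F E 2) Q hQ (toLocalFour F E c v (uMinus (UnitaryGroup.LocalRing E v) (UnitaryGroup.conjLocal E c v) (UnitaryGroup.conjLocal_conjLocal c v hcδ hδ) z)) *
                (FrameTransport.frameConj F E c v (2 + 2) hJ₂D (antidiagonal_over_eq_map F E 2) Q hQ (toLocalFour F E c v (weylTwo (UnitaryGroup.LocalRing E v) (UnitaryGroup.conjLocal E c v))) * FrameTransport.frameConj F E c v (2 + 2) hJ₂D (antidiagonal_over_eq_map F E 2) Q hQ (toLocalFour F E c v (uLongTwo (UnitaryGroup.LocalRing E v) (UnitaryGroup.conjLocal E c v) (UnitaryGroup.toLocalRing E v x * algebraMap E (UnitaryGroup.LocalRing E v) δ) (conjLocal_coord F E c hcδ v x))) * h))) ∂μF =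
          lFactor F v (chiF F E v χv) (((2 : ℕ) : ℂ) * s + 2 - 1) * N₁ s (FrameTransport.frameConj F E c v (2 + 2) hJ₂D (antidiagonal_over_eq_map F E 2) Q hQ (toLocalFour F E c v (weylOne (UnitaryGroup.LocalRing E v) (UnitaryGroup.conjLocal E c v))) * FrameTransport.frameConj F E c v (2 + 2) hJ₂D (antidiagonal_over_eq_map F E 2) Q hQ (toLocalFour F E c v (uMinus (UnitaryGroup.LocalRing E v) (UnitaryGroup.conjLocal E c v) (UnitaryGroup.conjLocal_conjLocal c v hcδ hδ) z)) *
                (FrameTransport.frameConj F E c v (2 + 2) hJ₂D (antidiagonal_over_eq_map F E 2) Q hQ (toLocalFour F E c v (weylTwo (UnitaryGroup.LocalRing E v) (UnitaryGroup.conjLocal E c v))) * FrameTransport.frameConj F E c v (2 + 2) hJ₂D (antidiagonal_over_eq_map F E 2) Q hQ (toLocalFour F E c v (uLongTwo (UnitaryGroup.LocalRing E v) (UnitaryGroup.conjLocal E c v) (UnitaryGroup.toLocalRing E v x * algebraMap E (UnitaryGroup.LocalRing E v) δ) (conjLocal_coord F E c hcδ v x))) * h)) := fun x z => (hN₁ s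 hs _).2
    have middle : ∀ x : v.adicCompletion F,
        ∫ z, lFactor F v (chiF F E v χv) (((2 : ℕ) : ℂ) * s + 2 - 1) * N₁ s (FrameTransport.frameConj F E c v (2 + 2) hJ₂D (antidiagonal_over_eq_map F E 2) Q hQ (toLocalFour F E c v (weylOne (UnitaryGroup.LocalRing E v) (UnitaryGroup.conjLocal E c v))) * FrameTransport.frameConj F E c v (2 + 2) hJ₂D (antidiagonal_over_eq_map F E 2) Q hQ (toLocalFour F E c v (uMinus (UnitaryGroup.LocalRing E v) (UnitaryGroup.conjLocal E c v) (UnitaryGroup.conjLocal_conjLocal c v hcδ hδ) z)) *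
                (FrameTransport.frameConj F E c v (2 + 2) hJ₂D (antidiagonal_over_eq_map F E 2) Q hQ (toLocalFour F E c v (weylTwo (UnitaryGroup.LocalRing E v) (UnitaryGroup.conjLocal E c v))) * FrameTransport.frameConj F E c v (2 + 2) hJ₂D (antidiagonal_over_eq_map F E 2) Q hQ (toLocalFour F E c v (uLongTwo (UnitaryGroup.LocalRing E v) (UnitaryGroup.conjLocal E c v) (UnitaryGroup.toLocalRing E v x * algebraMap E (UnitaryGroup.LocalRing E v) δ) (conjLocal_coord F E c hcδ v x))) * h)) ∂(Measure.map (⇑e₁) μw) =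
          lFactor F v (chiF F E v χv) (((2 : ℕ) : ℂ) * s + 2 - 1) * (lFactor E w.1 (chiNorm F E c v χv w) (((2 : ℕ) : ℂ) * s + 1 - 1) *
            N₂ s (FrameTransport.frameConj F E c v (2 + 2) hJ₂D (antidiagonal_over_eq_map F E 2) Q hQ (toLocalFour F E c v (weylTwo (UnitaryGroup.LocalRing E v) (UnitaryGroup.conjLocal E c v))) * FrameTransport.frameConj F E c v (2 + 2) hJ₂D (antidiagonal_over_eq_map F E 2) Q hQ (toLocalFour F E c v (uLongTwo (UnitaryGroup.LocalRing E v) (UnitaryGroup.conjLocal E c v) (UnitaryGroup.toLocalRing E v x * algebraMap E (UnitaryGroup.LocalRing E v) δ) (conjLocal_coord F E c hcδ v x))) * h)) := fun x => by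
      rw [hμRint, integral_const_mul]
      simp only [hmid]
      rw [(hN₂ s hs _).2]
    have outer : ∫ x, conj ((ψ (σ * x) : ℂ)) * (lFactor F v (chiF F E v χv) (((2 : ℕ) : ℂ) * s + 2 - 1) * (lFactor E w.1 (chiNorm F E c v χv w) (((2 : ℕ) : ℂ) * s + 1 - 1) *
            N₂ s (FrameTransport.frameConj F E c v (2 + 2) hJ₂D (antidiagonal_over_eq_map F E 2) Q hQ (toLocalFour F E c v (weylTwo (UnitaryGroup.LocalRing E v) (UnitaryGroup.conjLocal E c v))) * FrameTransport.frameConj F E c v (2 + 2) hJ₂D (antidiagonal_over_eq_map F E 2) Q hQ (toLocalFour F E c v (uLongTwo (UnitaryGroup.LocalRing E v) (UnitaryGroup.conjLocal E c v) (UnitaryGroup.toLocalRing E v x * algebraMap E (UnitaryGroup.LocalRing E v) δ) (conjLocal_coord F E c hcδ v x))) * h))) ∂μF =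
          lFactor F v (chiF F E v χv) (((2 : ℕ) : ℂ) * s + 2 - 1) * lFactor E w.1 (chiNorm F E c v χv w) (((2 : ℕ) : ℂ) * s + 1 - 1) * N₃ s h := by
      have hfun : (fun x : v.adicCompletion F => conj ((ψ (σ * x) : ℂ)) * (lFactor F v (chiF F E v χv) (((2 : ℕ) : ℂ) * s + 2 - 1) * (lFactor E w.1 (chiNorm F E c v χv w) (((2 : ℕ) : ℂ) * s + 1 - 1) *
            N₂ s (FrameTransport.frameConj F E c v (2 + 2) hJ₂D (antidiagonal_over_eq_map F E 2) Q hQ (toLocalFour F E c v (weylTwo (UnitaryGroup.LocalRing E v) (UnitaryGroup.conjLocal E c v))) * FrameTransport.frameConj F E c v (2 + 2) hJ₂D (antidiagonal_over_eq_map F E 2) Q hQ (toLocalFour F E c v (uLongTwo (UnitaryGroup.LocalRing E v) (UnitaryGroup.conjLocal E c v) (UnitaryGroup.toLocalRing E v x * algebraMap E (UnitaryGroup.LocalRing E v) δ) (conjLocal_coord F E c hcδ v x))) * h)))) =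
          fun x => lFactor F v (chiF F E v χv) (((2 : ℕ) : ℂ) * s + 2 - 1) * lFactor E w.1 (chiNorm F E c v χv w) (((2 : ℕ) : ℂ) * s + 1 - 1) * (conj ((ψ (σ * x) : ℂ)) * N₂ s (FrameTransport.frameConj F E c v (2 + 2) hJ₂D (antidiagonal_over_eq_map F E 2) Q hQ (toLocalFour F E c v (weylTwo (UnitaryGroup.LocalRing E v) (UnitaryGroup.conjLocal E c v))) * FrameTransport.frameConj F E c v (2 + 2) hJ₂D (antidiagonal_over_eq_map F E 2) Q hQ (toLocalFour F E c v (uLongTwo (UnitaryGroup.LocalRing E v) (UnitaryGroup.conjLocal E c v) (UnitaryGroup.toLocalRing E v x * algebraMap E (UnitaryGroup.LocalRing E v) δ) (conjLocal_coord F E c hcδ v x))) * h)) := by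
        funext x; ring
      rw [hfun, integral_const_mul, (hN₃ s hs h).2]
    simp_rw [inner, middle]
    rw [outer]
    -- the two numerators are `L_F(2s+1)` and `L_{E∕F}(2s)`
    have hL1 : lFactor F v (chiF F E v χv) (((2 : ℕ) : ℂ) * s + 2 - 1) = lF F E v χv (2 * s + 1) := by
      rw [lF]; congr 1; push_cast; ring
    have hL2 : lFactor E w.1 (chiNorm F E c v χv w) (((2 : ℕ) : ℂ) * s + 1 - 1) = lEN F E c v χv (2 * s) := by
      rw [lEN, Fintype.prod_eq_single w fun w' hw' => absurd (hw w') hw']; congr 1; push_cast; ring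
    rw [hL1, hL2]
  -- the two numerators in ★ T1 letters, for every `s`
  have hL1' : ∀ s : ℂ, lFactor F v (chiF F E v χv) (((2 : ℕ) : ℂ) * s + 2 - 1) = lF F E v χv (2 * s + 1) := fun s => by
    rw [lF]; congr 1; push_cast; ring
  have hL2' : ∀ s : ℂ, lFactor E w.1 (chiNorm F E c v χv w) (((2 : ℕ) : ℂ) * s + 1 - 1) = lEN F E c v χv (2 * s) := fun s => by
    rw [lEN, Fintype.prod_eq_single w fun w' hw' => absurd (hw w') hw']; congr 1; push_cast; ring
  refine ⟨A, N₁, N₂, N₃, fun s => localSiegelCharacter F E c v 2 χv s (weylDelta F E c v 2 hJ₂D (T₀ := T₂) * FrameTransport.frameConj F E c v (2 + 2) hJ₂D (antidiagonal_over_eq_map F E 2) Q hQ (toLocalFour F E c v (weylSiegel (UnitaryGroup.LocalRing E v) (UnitaryGroup.conjLocal E c v)))) * (((cN : ℝ) : ℂ) * (lF F E v χv (2 * s + 1) * lEN F E c v χv (2 * s))), hA, hN₂reg, hN₃reg, hκreg, fun h => ?_, fun s hs h => ?_, fun s hs h => hN₃ s hs h,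
    fun s₀ h0 h => hN₃ker s₀ h h0, fun s hs => ⟨fun g => by rw [hN₁eq s hs g, hL1'], fun g => by rw [hN₂eq s hs g, hL2']⟩, ⟨cN, hcN, fun s => rfl⟩⟩
  · exact differentiableOn_re_pos_of_forall_isQRationalRegularAt hq0 fun s₀ hs₀ => (hκreg s₀ hs₀).mul (hN₃reg s₀ h)
  · -- the Levi shift `w_Δ = m₀ · φ(w_Δ^J)` under the twisted integral (pointwise, as ★ B4d-3 §1 ∕ ★ (K1a-2) `hshift`)
    have hshift : ∀ u : unipDeltaLocal F E c v 2 (JD := J₂D), conj ((ψ (σ * (e3.symm u).1) : ℂ)) * f s (weylDelta F E c v 2 hJ₂D (T₀ := T₂) * (u : UnitaryGroup.localPi E c (2 + 2) J₂D v) * h) =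
        localSiegelCharacter F E c v 2 χv s (weylDelta F E c v 2 hJ₂D (T₀ := T₂) * FrameTransport.frameConj F E c v (2 + 2) hJ₂D (antidiagonal_over_eq_map F E 2) Q hQ (toLocalFour F E c v (weylSiegel (UnitaryGroup.LocalRing E v) (UnitaryGroup.conjLocal E c v)))) * (conj ((ψ (σ * (e3.symm u).1) : ℂ)) * f s (FrameTransport.frameConj F E c v (2 + 2) hJ₂D (antidiagonal_over_eq_map F E 2) Q hQ (toLocalFour F E c v (weylSiegel (UnitaryGroup.LocalRing E v) (UnitaryGroup.conjLocal E c v))) * (u : UnitaryGroup.localPi E c (2 + 2) J₂D v) * h)) := fun u => by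
      conv_lhs => rw [weylDelta_eq_mul_frameConj_weylSiegel F E c v hJ₂D Q hQ]
      rw [mul_assoc (weylDelta F E c v 2 hJ₂D (T₀ := T₂) * FrameTransport.frameConj F E c v (2 + 2) hJ₂D (antidiagonal_over_eq_map F E 2) Q hQ (toLocalFour F E c v (weylSiegel (UnitaryGroup.LocalRing E v) (UnitaryGroup.conjLocal E c v)))), mul_assoc (weylDelta F E c v 2 hJ₂D (T₀ := T₂) * FrameTransport.frameConj F E c v (2 + 2) hJ₂D (antidiagonal_over_eq_map F E 2) Q hQ (toLocalFour F E c v (weylSiegel (UnitaryGroup.LocalRing E v) (UnitaryGroup.conjLocal E c v)))),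
        (hSieg s) _ (isSiegelDelta_weylDelta_mul_frameConj_weylSiegel F E c hcδ hδ hd v hT₂ hJ₂D D Dinv hDD Q hQm hQ), ← mul_assoc]
      ring
    simp_rw [hshift]
    rw [integral_const_mul, hframe s hs h]
    ring

end Summit.HodgeConjecture.HodgeConjecture.Cruxes.HLiu418.K2LiuSingularWhittakerLocalReading

end
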